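import Summits.QuantumAdvantage.QuantumAdvantage.Theorems.LocusDialDeclarable

/-!
# LocusDialDeclarableM — DECLARABILITY for every `m`: `MFreeAnchorLoss3 → U`

Cell decomp-qadv, seat lens-2, generation 17 — tree part (supports item stmt-QuantumAdvantage-27137
`Theses.StabilizerDial.FewLocusLoss3` = `Theorems.LocusDial.FewLocusLoss3`, piece `U`; companion of `LocusDialDeclarable`).

THE RESULT.  `mFreeAnchorable_of_fewLocus (m r c)`: for `n ≥ 2^{36m+4}`, every degree-`(log₂ n)^c` strategy that is
few-locus at `(m, r)` (`FewLocus m r P`: a.e. its deviation set is covered by `m` windows of width `r`, at ARBITRARY,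
input-dependent, possibly UNSTABLE locations) is `MFreeAnchorable m r (c+3) P`: the `m` windows are DECLARED, a.e. uniquely,
by low-degree anchor families.  Hence **`fewLocusLoss3_of_mFreeAnchorLoss3 : MFreeAnchorLoss3 → FewLocusLoss3`** — the
unstable-anchor law («a.e.-declared, possibly unstable windows lose»; NECESSARY, `mFreeAnchorLoss3_of_polyLossOddU3`) GIVES
piece `U` outright: `T → MFreeAnchorLoss3 → U` by name (`fewLocusLoss3_of_polyLossOddU3'`).  «Undeclarable loci» do not exist
at polylog degree; the ENTIRE open content of `U` is the STABILITY clause that separates `MFreeAnchorable` from g15's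
`MAnchorable` (whose law `MultiAnchorLoss3` is PROVED).

THE CONSTRUCTION (GREEDY RECURSION).  §R5a combinatorics of the greedy window starts `gposN P r x j` (least deviation, then
repeatedly the least deviation beyond the current window, else the same start again): `greedy_cover` (everything not beyond
window `j` is covered by windows `0..j`), `greedy_chain` (while something remains, the starts are deviations with consecutive
gaps `> r`), `greedy_exhausts` (PIGEONHOLE: an `(m, r)`-coverable set leaves nothing beyond window `m-1` — `m+1` deviations
pairwise `> r` apart cannot sit in `m` windows), `greedy_near`.  §R5b the polynomials: transition `stepPoly k' k` («`k` is the
least deviation beyond the window at `k'`, or `k = k'` and there is none», NORs read through `razNor` with index sets `Ibtw`,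
`Iaft`), the families `gAncM j` (`gAncM 0 = greedyAnc`, `gAncM (j+1) k = Σ_{k'} gAncM j k' · stepPoly k' k`), degrees
(`gAncM_mem`: `(j+1)·(d_D + ℓ·2d_D)`), and SEMANTICS on the good inputs `GoodX` (no approximant errs): `stepPoly_apply` /
`stepSel_iff`, **`gAncM_apply`** (`gAncM j k x = [k = gposN j]`), `card_gAncM_eq_one`.  §R5c budgets (`seed_budgetM`: one seed
for all `n + n² + n` sub-families with `ℓ = 4 log₂ n`, `exists_good_razSeed'`; `greedyM_degree_budget`), the theorem, and
`MFreeAnchorLoss3 → U`.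
No `sorry`; standard axioms; no instances, no notation; Prop defs `GoodX`, `StepSel` are plain predicates used in proofs.
-/

set_option linter.dupNamespace false

noncomputable section

open scoped Classical

namespace Summit.QuantumAdvantage.QuantumAdvantage.Theorems.LocusDial

open Finset
open Literature.Computability.MetaComplexity Literature.Computability.MetaComplexity.Smolensky

variable {N A ℓ : ℕ}

/-! ## §R5  GENERAL `m`: the greedy recursion -/

section GreedyM

open Literature.Computability.QuantumComplexity Literature.Computability.QuantumComplexity.RingHLF
open Summit.QuantumAdvantage.AdviceFreeQNC0
open Summit.QuantumAdvantage.QuantumAdvantage.Theorems.AnchorDial (dev MAnchorable)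

/-- seeds for an arbitrary finite index type of sub-families. -/
theorem exists_good_razSeed' {ι : Type} [Fintype ι] (I : ι → Finset (Fin A)) (D : Fin A → CubeFn (ZMod 3) N) :
    ∃ c : Fin ℓ → Fin A → ZMod 3,
      (univ.filter fun x : Fin N → Bool => ∃ a : ι, RazErr c (I a) D x).card * 3 ^ ℓ ≤ Fintype.card ι * 2 ^ N := by
  obtain ⟨c, hc⟩ := exists_good_razSeed (ℓ := ℓ) (fun a : Fin (Fintype.card ι) => I ((Fintype.equivFin ι).symm a)) D
  refine ⟨c, le_trans (le_of_eq ?_) hc⟩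
  congr 2
  apply filter_congr
  intro x _
  constructor
  · rintro ⟨a, ha⟩
    exact ⟨Fintype.equivFin ι a, by simpa using ha⟩
  · rintro ⟨a, ha⟩
    exact ⟨_, ha⟩

variable (P : Fin N → CubeFn (ZMod 3) N) (r : ℕ)

/-- the deviations strictly beyond the window `[q, q + r]`. -/
def nxtSet (x : Fin N → Bool) (q : ℕ) : Finset (Fin N) := (dev P x).filter fun i => q + r < i.val

/-- LocusDialDeclarableM helper `mem_nxtSet` (decomp-qadv land package; see the module docstring). -/
theorem mem_nxtSet {x : Fin N → Bool} {q : ℕ} {i : Fin N} : i ∈ nxtSet P r x q ↔ i ∈ dev P x ∧ q + r < i.val := by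
  unfold nxtSet; exact mem_filter

/-- the GREEDY window starts: the least deviation (or `0`), then repeatedly the least deviation beyond the current window
(or the current start again, if there is none). -/
def gposN (x : Fin N → Bool) : ℕ → ℕ
  | 0 => if h : (dev P x).Nonempty then ((dev P x).min' h).val else 0
  | j + 1 => if h : (nxtSet P r x (gposN x j)).Nonempty then ((nxtSet P r x (gposN x j)).min' h).val else gposN x j

/-- LocusDialDeclarableM helper `gposN_lt` (decomp-qadv land package; see the module docstring). -/
theorem gposN_lt (hN : 1 ≤ N) (x : Fin N → Bool) : ∀ j, gposN P r x j < N
  | 0 => by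
    unfold gposN
    split_ifs with h
    · exact Fin.isLt _
    · omega
  | j + 1 => by
    show (if h : (nxtSet P r x (gposN P r x j)).Nonempty then ((nxtSet P r x (gposN P r x j)).min' h).val
      else gposN P r x j) < N
    split_ifs with h
    · exact Fin.isLt _
    · exact gposN_lt hN x j

/-- LocusDialDeclarableM helper `gposN_succ` (decomp-qadv land package; see the module docstring). -/
theorem gposN_succ (x : Fin N → Bool) (j : ℕ) : gposN P r x (j + 1) =
    if h : (nxtSet P r x (gposN P r x j)).Nonempty then ((nxtSet P r x (gposN P r x j)).min' h).val
      else gposN P r x j := rfl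

/-- LocusDialDeclarableM helper `gposN_mono` (decomp-qadv land package; see the module docstring). -/
theorem gposN_mono (x : Fin N → Bool) (j : ℕ) : gposN P r x j ≤ gposN P r x (j + 1) := by
  rw [gposN_succ]
  split_ifs with h
  · have hm := ((mem_nxtSet P r).1 (min'_mem _ h)).2
    omega
  · exact le_rfl

/-- COVERAGE: every deviation not beyond the `j`-th window is covered by one of the windows `0..j`. -/
theorem greedy_cover (x : Fin N → Bool) : ∀ j : ℕ, ∀ i ∈ dev P x, i ∉ nxtSet P r x (gposN P r x j) →
    ∃ s, s ≤ j ∧ gposN P r x s ≤ i.val ∧ i.val ≤ gposN P r x s + r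
  | 0 => by
    intro i hi hn
    unfold nxtSet at hn
    rw [mem_filter, not_and] at hn
    have hle := not_lt.1 (hn hi)
    refine ⟨0, le_rfl, ?_, hle⟩
    have hD : (dev P x).Nonempty := ⟨i, hi⟩
    show (if h : (dev P x).Nonempty then ((dev P x).min' h).val else 0) ≤ i.val
    rw [dif_pos hD]
    exact Fin.le_def.1 (min'_le _ i hi)
  | j + 1 => by
    intro i hi hn
    unfold nxtSet at hn
    rw [mem_filter, not_and] at hn
    have hle := not_lt.1 (hn hi)
    by_cases hc : gposN P r x j + r < i.val
    · have hmem : i ∈ nxtSet P r x (gposN P r x j) := by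
        unfold nxtSet; rw [mem_filter]; exact ⟨hi, hc⟩
      have hne : (nxtSet P r x (gposN P r x j)).Nonempty := ⟨i, hmem⟩
      refine ⟨j + 1, le_rfl, ?_, hle⟩
      rw [gposN_succ, dif_pos hne]
      exact Fin.le_def.1 (min'_le _ i hmem)
    · obtain ⟨s, hs, h1, h2⟩ := greedy_cover x j i hi (by
        unfold nxtSet; rw [mem_filter, not_and]; exact fun _ => hc)
      exact ⟨s, by omega, h1, h2⟩

/-- the CHAIN: while deviations remain beyond the `j`-th window, the starts `0..j` are deviations with consecutive gaps `> r`. -/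
theorem greedy_chain (x : Fin N → Bool) : ∀ j : ℕ, (nxtSet P r x (gposN P r x j)).Nonempty →
    (∀ s, s ≤ j → ∃ i ∈ dev P x, i.val = gposN P r x s) ∧ (∀ s, s < j → gposN P r x s + r < gposN P r x (s + 1))
  | 0 => by
    intro hne
    refine ⟨fun s hs => ?_, fun s hs => by omega⟩
    obtain rfl : s = 0 := by omega
    obtain ⟨u, hu⟩ := hne
    unfold nxtSet at hu
    have hD : (dev P x).Nonempty := ⟨u, (mem_filter.1 hu).1⟩
    refine ⟨(dev P x).min' hD, min'_mem _ hD, ?_⟩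
    show ((dev P x).min' hD).val = (if h : (dev P x).Nonempty then ((dev P x).min' h).val else 0)
    rw [dif_pos hD]
  | j + 1 => by
    intro hne
    -- the previous stage was nonempty too (monotone thresholds)
    have hprev : (nxtSet P r x (gposN P r x j)).Nonempty := by
      obtain ⟨u, hu⟩ := hne
      unfold nxtSet at hu ⊢
      rw [mem_filter] at hu
      have hm := gposN_mono P r x j
      exact ⟨u, mem_filter.2 ⟨hu.1, by omega⟩⟩
    obtain ⟨ih1, ih2⟩ := greedy_chain x j hprev
    have hstep : gposN P r x (j + 1) = ((nxtSet P r x (gposN P r x j)).min' hprev).val := by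
      rw [gposN_succ, dif_pos hprev]
    have hm := min'_mem _ hprev
    refine ⟨fun s hs => ?_, fun s hs => ?_⟩
    · rcases Nat.lt_or_ge s (j + 1) with h | h
      · exact ih1 s (by omega)
      · obtain rfl : s = j + 1 := by omega
        refine ⟨_, ?_, hstep.symm⟩
        unfold nxtSet at hm
        exact (mem_filter.1 hm).1
    · rcases Nat.lt_or_ge s j with h | h
      · exact ih2 s h
      · obtain rfl : s = j := by omega
        rw [hstep]
        unfold nxtSet at hm
        exact (mem_filter.1 hm).2

/-- OPTIMALITY: if the deviation set is `(m, r)`-coverable then nothing remains beyond the `(m-1)`-th greedy window. -/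
theorem greedy_exhausts {m : ℕ} (hm : 1 ≤ m) (x : Fin N → Bool) (hcov : Coverable m r (dev P x)) :
    ¬ (nxtSet P r x (gposN P r x (m - 1))).Nonempty := by
  intro hne
  obtain ⟨kv, hkv⟩ := hcov
  obtain ⟨hdev, hgap⟩ := greedy_chain P r x (m - 1) hne
  obtain ⟨u, hu⟩ := hne
  unfold nxtSet at hu
  rw [mem_filter] at hu
  -- the m+1 points
  set q : Fin (m + 1) → ℕ := fun t => if h : t.val ≤ m - 1 then gposN P r x t.val else u.val with hq
  have hqdev : ∀ t : Fin (m + 1), ∃ i ∈ dev P x, i.val = q t := by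
    intro t
    by_cases h : t.val ≤ m - 1
    · rw [hq]; simp only [dif_pos h]; exact hdev t.val h
    · rw [hq]; simp only [dif_neg h]; exact ⟨u, hu.1, rfl⟩
  have hqgap : ∀ s t : Fin (m + 1), s.val < t.val → q s + r < q t := by
    -- consecutive gaps, then chain them
    have hcons : ∀ a : ℕ, a + 1 ≤ m → (if a ≤ m - 1 then gposN P r x a else u.val) + r <
        (if a + 1 ≤ m - 1 then gposN P r x (a + 1) else u.val) := by
      intro a ha
      rw [if_pos (by omega)]
      by_cases h2 : a + 1 ≤ m - 1
      · rw [if_pos h2]; exact hgap a (by omega)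
      · rw [if_neg h2]
        obtain rfl : a = m - 1 := by omega
        exact hu.2
    have hmono : ∀ a b : ℕ, a < b → b ≤ m → (if a ≤ m - 1 then gposN P r x a else u.val) + r <
        (if b ≤ m - 1 then gposN P r x b else u.val) := by
      intro a b hab hb
      induction b with
      | zero => omega
      | succ b ih =>
        rcases Nat.lt_or_ge a b with h | h
        · have := ih h (by omega)
          have := hcons b hb
          omega
        · obtain rfl : a = b := by omega
          exact hcons a hb
    intro s t hst
    have := hmono s.val t.val hst (by omega)
    rw [hq]
    simpa [Fin.val] using this
  -- pigeonhole into the m windows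
  have hwin : ∀ t : Fin (m + 1), ∃ j : Fin m, kv j ≤ q t ∧ q t ≤ kv j + r := by
    intro t
    obtain ⟨i, hi, hiq⟩ := hqdev t
    obtain ⟨j, hj⟩ := hkv i hi
    exact ⟨j, by rw [← hiq]; exact hj⟩
  choose w hw using hwin
  obtain ⟨s, t, hst, hwst⟩ := Fintype.exists_ne_map_eq_of_card_lt w (by simp)
  rcases lt_or_gt_of_ne (fun h => hst (Fin.ext h)) with h | h
  · have h1 := hqgap s t h
    have h2 := hw s
    have h3 := hw t
    rw [hwst] at h2
    omega
  · have h1 := hqgap t s h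
    have h2 := hw s
    have h3 := hw t
    rw [hwst] at h2
    omega

/-- NEAR for the greedy starts: an `(m, r)`-coverable deviation set is covered by the `m` greedy windows. -/
theorem greedy_near {m : ℕ} (hm : 1 ≤ m) (x : Fin N → Bool) (hcov : Coverable m r (dev P x)) :
    ∀ i ∈ dev P x, ∃ s, s < m ∧ gposN P r x s ≤ i.val ∧ i.val ≤ gposN P r x s + r := by
  intro i hi
  have hex := greedy_exhausts P r hm x hcov
  have hni : i ∉ nxtSet P r x (gposN P r x (m - 1)) := fun h => hex ⟨i, h⟩
  obtain ⟨s, hs, h1, h2⟩ := greedy_cover P r x (m - 1) i hi hni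
  exact ⟨s, by omega, h1, h2⟩

/-! ### §R5b the polynomials of the greedy recursion -/

open Summit.QuantumAdvantage.QuantumAdvantage.Theorems.HolonomyDial (selP selP_mem selP_apply xorP xorP_mem
  xorP_apply_bool tPoly tPoly_mem tPoly_apply)

/-- the next start after a window at `q`: the least deviation beyond it, or `q` again. -/
def nxtPosN (x : Fin N → Bool) (q : ℕ) : ℕ :=
  if h : (nxtSet P r x q).Nonempty then ((nxtSet P r x q).min' h).val else q

/-- LocusDialDeclarableM helper `gposN_succ_eq` (decomp-qadv land package; see the module docstring). -/
theorem gposN_succ_eq (x : Fin N → Bool) (j : ℕ) : gposN P r x (j + 1) = nxtPosN P r x (gposN P r x j) := rfl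

/-- positions strictly between the end of the window at `k'` and `k`. -/
def Ibtw (N r : ℕ) (k' k : Fin N) : Finset (Fin N) := univ.filter fun i : Fin N => k'.val + r < i.val ∧ i.val < k.val

/-- positions strictly beyond the window at `k'`. -/
def Iaft (N r : ℕ) (k' : Fin N) : Finset (Fin N) := univ.filter fun i : Fin N => k'.val + r < i.val

variable (c : Fin ℓ → Fin N → ZMod 3)

/-- the transition polynomial of the greedy recursion: from a window at `k'` to the next start `k`. -/
def stepPoly (k' k : Fin N) : CubeFn (ZMod 3) N :=
  (if k'.val + r < k.val then devPoly P k * razNor c (Ibtw N r k' k) (devPoly P) else 0) +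
  (if k = k' then razNor c (Iaft N r k') (devPoly P) else 0)

/-- the `j`-th GREEDY anchor family (as polynomials read through Razborov approximants with the shared seed `c`). -/
def gAncM : ℕ → Fin N → CubeFn (ZMod 3) N
  | 0 => greedyAnc P c
  | j + 1 => fun k => ∑ k' : Fin N, gAncM j k' * stepPoly P r c k' k

/-- LocusDialDeclarableM helper `stepPoly_mem` (decomp-qadv land package; see the module docstring). -/
theorem stepPoly_mem {d : ℕ} (hP : ∀ i, P i ∈ lowDeg (ZMod 3) N d) (k' k : Fin N) :
    stepPoly P r c k' k ∈ lowDeg (ZMod 3) N ((2 + (d + d)) + ℓ * (2 * (2 + (d + d)))) := by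
  have hD := devPoly_mem hP
  unfold stepPoly
  refine Submodule.add_mem _ ?_ ?_
  · split_ifs
    · exact mul_mem_lowDeg_add (hD k) (razNor_mem c _ hD)
    · exact Submodule.zero_mem _
  · split_ifs
    · exact lowDeg_mono (by omega) (razNor_mem c _ hD)
    · exact Submodule.zero_mem _

/-- LocusDialDeclarableM helper `gAncM_mem` (decomp-qadv land package; see the module docstring). -/
theorem gAncM_mem {d : ℕ} (hP : ∀ i, P i ∈ lowDeg (ZMod 3) N d) :
    ∀ j (k : Fin N), gAncM P r c j k ∈ lowDeg (ZMod 3) N ((j + 1) * ((2 + (d + d)) + ℓ * (2 * (2 + (d + d)))))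
  | 0, k => by
    show greedyAnc P c k ∈ _
    exact lowDeg_mono (le_of_eq (by ring)) (greedyAnc_mem hP c k)
  | j + 1, k => by
    show ∑ k' : Fin N, gAncM P r c j k' * stepPoly P r c k' k ∈ _
    refine Submodule.sum_mem _ fun k' _ => ?_
    have h := mul_mem_lowDeg_add (gAncM_mem hP j k') (stepPoly_mem P r c hP k' k)
    refine lowDeg_mono (le_of_eq ?_) h
    ring


end GreedyM
end Summit.QuantumAdvantage.QuantumAdvantage.Theorems.LocusDial
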